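import Summits.KontsevichZagierPeriods.Zeta5Search.Barrier.ConeGammaRates

/-!
# ζ(5) search — BARRIER: the ENTROPY FORM of Brown–Zudilin's critical values (value identity)

HONEST FRAMING (cell `pub-zeta5`): systematic search; no irrationality claim unless kernel-certified. MODEL objects
under Brown–Zudilin's (28)+(30) accounting ([BZ22] = arXiv:2210.03391, §5); nothing here is a statement about
`ζ(5)`; no `γ` moves; records in print UNMOVED. Prover P2 g12 (`HOME/pub-zeta5-p2/g12/iv/ENVELOPE-NOTE.md`).

BZ's system `F₁ = F₂ = 0` (`F1R`, `F2R`) is the multiplicative form of the critical-point equations of the ENTROPY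
FUNCTION `G(x,y) = Σ_i σ_i (L_i log|L_i| − L_i)` over the fourteen affine forms `L_i(x,y)` of the system
(`x`, `y`, `x+y+q₃−p₀−p₆` with sign `+`; the eleven others with sign `−`), and ON THE CRITICAL SET the growth
functional `growthLogR` (BZ's log-product `log|λ(x,y)|`, display p. 12) equals `G` up to an explicit function of the
parameters alone:

* `entropyG`, `entropyGx`, `entropyGy` — `G` and the log-forms of `∂G/∂x`, `∂G/∂y`;
* `entropyGx_eq_zero`, `entropyGy_eq_zero` — `F₁ = 0 ⇒ ∂G/∂x-form = 0`, `F₂ = 0 ⇒ ∂G/∂y-form = 0` (logs of the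
  two products; all factors non-zero);
* `entropyG_eq` — the algebraic decomposition `G = x·Gx + y·Gy + Σ_k e_k log|v_k| − (p₃+q₃−q₁−q₂−q₄−q₅)` valid for
  ALL `(x,y)` (the exponents `e_k = critExps` are exactly `σ_i c_i`, the constants of the forms times their signs);
* **`growthLogR_eq_entropyG`** — for every solution of `F₁ = F₂ = 0` with `x, y` and the twelve arguments non-zero,
  `growthLogR p q x y = entropyG p q x y + (p₃+q₃−q₁−q₂−q₄−q₅) + Σ_k ±c_k log c_k`; `…_of_isCritical` for directions.

Why it matters (ENVELOPE-NOTE §3): along a smooth branch of simple critical points the DERIVATIVE of a critical value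
with respect to any parameter is `∂G/∂(parameter)` at the critical point — a closed form in `(x, y, p, q)` with no
derivative of the root (envelope theorem); this is what the P2 g12 independent S-B verifier uses for its first-order
box bounds, and it gives the exact gradient of `C₁`, `C₀`, `c_I` in the direction. Only the algebraic identities are
filed here (0 sorry); the calculus step is not.
-/

noncomputable section

open Finset

namespace Summit.KontsevichZagierPeriods.Zeta5Search.Barrier.ConeGamma

/-- The Stirling-type entropy term `v log|v| − v` (derivative `log|v|` away from `0`). -/
def xlnx (v : ℝ) : ℝ := v * Real.log |v| - v

/-- **The entropy function** of BZ's §5 system: `Σ_i σ_i (L_i log|L_i| − L_i)` over the fourteen affine forms. -/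
def entropyG (p : Fin 7 → ℝ) (q : Fin 5 → ℝ) (x y : ℝ) : ℝ :=
  xlnx x + xlnx y + xlnx (x + y + q 2 - p 0 - p 6)
    - xlnx (p 1 + q 0 - x) - xlnx (p 2 + q 1 - x) - xlnx (x - p 0) - xlnx (x - p 1) - xlnx (x - p 2)
    - xlnx (x + y - p 3)
    - xlnx (p 4 + q 3 - y) - xlnx (p 5 + q 4 - y) - xlnx (y - p 4) - xlnx (y - p 5) - xlnx (y - p 6)

/-- The log-form of `∂G/∂x`: `Σ_i σ_i a_i log|L_i|` (`a_i` = the `x`-coefficient of `L_i`). -/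
def entropyGx (p : Fin 7 → ℝ) (q : Fin 5 → ℝ) (x y : ℝ) : ℝ :=
  Real.log |x| + Real.log |p 1 + q 0 - x| + Real.log |p 2 + q 1 - x| + Real.log |x + y + q 2 - p 0 - p 6|
    - Real.log |x - p 0| - Real.log |x - p 1| - Real.log |x - p 2| - Real.log |x + y - p 3|

/-- The log-form of `∂G/∂y`: `Σ_i σ_i b_i log|L_i|` (`b_i` = the `y`-coefficient of `L_i`). -/
def entropyGy (p : Fin 7 → ℝ) (q : Fin 5 → ℝ) (x y : ℝ) : ℝ :=
  Real.log |y| + Real.log |x + y + q 2 - p 0 - p 6| + Real.log |p 4 + q 3 - y| + Real.log |p 5 + q 4 - y|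
    - Real.log |x + y - p 3| - Real.log |y - p 4| - Real.log |y - p 5| - Real.log |y - p 6|

/-- `F₁ = 0` is the multiplicative form of `∂G/∂x = 0`: for a solution with `x` and the `x`-factors non-zero the
log-form `entropyGx` vanishes. -/
theorem entropyGx_eq_zero {p : Fin 7 → ℝ} {q : Fin 5 → ℝ} {x y : ℝ} (h1 : F1R p q x y = 0) (hx : x ≠ 0)
    (h0 : x - p 0 ≠ 0) (h1' : x - p 1 ≠ 0) (h2 : x - p 2 ≠ 0) (h3 : x + y - p 3 ≠ 0)
    (h4 : p 1 + q 0 - x ≠ 0) (h5 : p 2 + q 1 - x ≠ 0) (h6 : x + y + q 2 - p 0 - p 6 ≠ 0) :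
    entropyGx p q x y = 0 := by
  have e : x * (p 1 + q 0 - x) * (p 2 + q 1 - x) * (x + y + q 2 - p 0 - p 6)
      = (x - p 0) * (x - p 1) * (x - p 2) * (x + y - p 3) := sub_eq_zero.mp h1
  have e' := congrArg (fun v : ℝ => Real.log |v|) e
  simp only [abs_mul] at e'
  rw [Real.log_mul (by positivity) (abs_ne_zero.mpr h6), Real.log_mul (by positivity) (abs_ne_zero.mpr h5),
    Real.log_mul (abs_ne_zero.mpr hx) (abs_ne_zero.mpr h4)] at e'
  rw [Real.log_mul (by positivity) (abs_ne_zero.mpr h3), Real.log_mul (by positivity) (abs_ne_zero.mpr h2),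
    Real.log_mul (abs_ne_zero.mpr h0) (abs_ne_zero.mpr h1')] at e'
  unfold entropyGx
  linarith

/-- `F₂ = 0` is the multiplicative form of `∂G/∂y = 0`. -/
theorem entropyGy_eq_zero {p : Fin 7 → ℝ} {q : Fin 5 → ℝ} {x y : ℝ} (h2 : F2R p q x y = 0) (hy : y ≠ 0)
    (h3 : x + y - p 3 ≠ 0) (h6 : x + y + q 2 - p 0 - p 6 ≠ 0) (h7 : y - p 4 ≠ 0) (h8 : y - p 5 ≠ 0)
    (h9 : y - p 6 ≠ 0) (h10 : p 4 + q 3 - y ≠ 0) (h11 : p 5 + q 4 - y ≠ 0) :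
    entropyGy p q x y = 0 := by
  have e : (x + y + q 2 - p 0 - p 6) * (p 4 + q 3 - y) * (p 5 + q 4 - y) * y
      = (x + y - p 3) * (y - p 4) * (y - p 5) * (y - p 6) := sub_eq_zero.mp h2
  have e' := congrArg (fun v : ℝ => Real.log |v|) e
  simp only [abs_mul] at e'
  rw [Real.log_mul (by positivity) (abs_ne_zero.mpr hy), Real.log_mul (by positivity) (abs_ne_zero.mpr h11),
    Real.log_mul (abs_ne_zero.mpr h6) (abs_ne_zero.mpr h10)] at e'
  rw [Real.log_mul (by positivity) (abs_ne_zero.mpr h9), Real.log_mul (by positivity) (abs_ne_zero.mpr h8),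
    Real.log_mul (abs_ne_zero.mpr h3) (abs_ne_zero.mpr h7)] at e'
  unfold entropyGy
  linarith

/-- **Algebraic decomposition of the entropy function** (valid for all `(x,y)`):
`G = x·Gx + y·Gy + Σ_k e_k log|v_k| − (p₃ + q₃ − q₁ − q₂ − q₄ − q₅)` — the signed exponents `e_k` of BZ's
log-product are the signed constant terms of the fourteen forms. -/
theorem entropyG_eq (p : Fin 7 → ℝ) (q : Fin 5 → ℝ) (x y : ℝ) :
    entropyG p q x y = x * entropyGx p q x y + y * entropyGy p q x y
      + (∑ k, critExps p q k * Real.log |critFactors p q x y k|)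
      - (p 3 + q 2 - q 0 - q 1 - q 3 - q 4) := by
  simp only [entropyG, entropyGx, entropyGy, xlnx, critExps, critFactors, Fin.sum_univ_succ, Fin.sum_univ_zero,
    Matrix.cons_val_zero, Matrix.cons_val_succ]
  ring

/-- **Value identity.** At every solution of BZ's system `F₁ = F₂ = 0` (with `x`, `y` and the twelve arguments
non-zero) the growth functional `log|λ(x,y)|` equals the entropy function plus an explicit function of the parameters:
`growthLogR = G + (p₃+q₃−q₁−q₂−q₄−q₅) + Σ_k ±c_k log c_k`. -/
theorem growthLogR_eq_entropyG {p : Fin 7 → ℝ} {q : Fin 5 → ℝ} {x y : ℝ} (h1 : F1R p q x y = 0)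
    (h2 : F2R p q x y = 0) (hx : x ≠ 0) (hy : y ≠ 0) (hF : ∀ k, critFactors p q x y k ≠ 0) :
    growthLogR p q x y = entropyG p q x y + (p 3 + q 2 - q 0 - q 1 - q 3 - q 4)
      + ∑ k, constSigns k * (constArgs p q k * Real.log (constArgs p q k)) := by
  have f0 := hF 0; have f1 := hF 1; have f2 := hF 2; have f3 := hF 3; have f4 := hF 4; have f5 := hF 5
  have f6 := hF 6; have f7 := hF 7; have f8 := hF 8; have f9 := hF 9; have f10 := hF 10; have f11 := hF 11
  simp only [critFactors, Matrix.cons_val_zero, Matrix.cons_val_one, Matrix.cons_val] at f0 f1 f2 f3 f4 f5 f6 f7 f8 f9 f10 f11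
  have Gx := entropyGx_eq_zero h1 hx f0 f1 f2 f3 f4 f5 f6
  have Gy := entropyGy_eq_zero h2 hy f3 f6 f7 f8 f9 f10 f11
  rw [entropyG_eq, Gx, Gy, growthLogR]
  ring

/-- The value identity for a direction `a` at a critical point (`IsCritical a x y`, `x ≠ 0`, `y ≠ 0`). -/
theorem growthLogR_eq_entropyG_of_isCritical {a : Dir} {x y : ℝ} (hc : IsCritical a x y) (hx : x ≠ 0)
    (hy : y ≠ 0) :
    growthLogR (pR a) (qR a) x y = entropyG (pR a) (qR a) x y
      + (pR a 3 + qR a 2 - qR a 0 - qR a 1 - qR a 3 - qR a 4)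
      + ∑ k, constSigns k * (constArgs (pR a) (qR a) k * Real.log (constArgs (pR a) (qR a) k)) :=
  growthLogR_eq_entropyG hc.1 hc.2.1 hx hy hc.2.2

/-! ### `Gx`, `Gy` ARE the partial derivatives of `G` (so `F₁ = F₂ = 0` says: `(x,y)` is a critical point of `G`) -/

/-- `d/dv (v log|v| − v) = log|v|` away from `0`. -/
theorem hasDerivAt_xlnx {v : ℝ} (hv : v ≠ 0) : HasDerivAt xlnx (Real.log |v|) v := by
  have h := (Real.hasDerivAt_mul_log hv).sub (hasDerivAt_id v)
  refine (h.congr_of_eventuallyEq (Filter.Eventually.of_forall fun z => ?_)).congr_deriv ?_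
  · simp [xlnx, Real.log_abs]
  · simp [Real.log_abs]

/-- Chain rule for `xlnx (x + c)` in `x`. -/
theorem hasDerivAt_xlnx_add (x c : ℝ) (h : x + c ≠ 0) :
    HasDerivAt (fun x => xlnx (x + c)) (Real.log |x + c|) x := by
  have d := (hasDerivAt_xlnx h).comp x ((hasDerivAt_id x).add_const c)
  refine (d.congr_of_eventuallyEq (Filter.Eventually.of_forall fun z => ?_)).congr_deriv ?_
  · simp
  · simp

/-- Chain rule for `xlnx (c - x)` in `x`. -/
theorem hasDerivAt_xlnx_sub (x c : ℝ) (h : c - x ≠ 0) :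
    HasDerivAt (fun x => xlnx (c - x)) (-Real.log |c - x|) x := by
  have d := (hasDerivAt_xlnx h).comp x ((hasDerivAt_id x).const_sub c)
  refine (d.congr_of_eventuallyEq (Filter.Eventually.of_forall fun z => ?_)).congr_deriv ?_
  · simp
  · simp

/-- **`∂G/∂x = Gx`**: the `x`-partial derivative of the entropy function is the log-form `entropyGx`
(all `x`-dependent forms non-zero). Hence `F₁ = 0` (⇒ `Gx = 0`, `entropyGx_eq_zero`) is `∂G/∂x = 0`. -/
theorem hasDerivAt_entropyG_x {p : Fin 7 → ℝ} {q : Fin 5 → ℝ} {x y : ℝ} (hx : x ≠ 0)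
    (h0 : x - p 0 ≠ 0) (h1 : x - p 1 ≠ 0) (h2 : x - p 2 ≠ 0) (h3 : x + y - p 3 ≠ 0)
    (h4 : p 1 + q 0 - x ≠ 0) (h5 : p 2 + q 1 - x ≠ 0) (h6 : x + y + q 2 - p 0 - p 6 ≠ 0) :
    HasDerivAt (fun x => entropyG p q x y) (entropyGx p q x y) x := by
  have dx : HasDerivAt (fun x => xlnx x) (Real.log |x|) x := hasDerivAt_xlnx hx
  have d6 := hasDerivAt_xlnx_add x (y + q 2 - p 0 - p 6) (by intro h; apply h6; linarith)
  have d4 := hasDerivAt_xlnx_sub x (p 1 + q 0) h4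
  have d5 := hasDerivAt_xlnx_sub x (p 2 + q 1) h5
  have d0 := hasDerivAt_xlnx_add x (-p 0) (by intro h; apply h0; linarith)
  have d1 := hasDerivAt_xlnx_add x (-p 1) (by intro h; apply h1; linarith)
  have d2 := hasDerivAt_xlnx_add x (-p 2) (by intro h; apply h2; linarith)
  have d3 := hasDerivAt_xlnx_add x (y - p 3) (by intro h; apply h3; linarith)
  have sum := ((((((((dx.add_const (xlnx y)).add d6).sub d4).sub d5).sub d0).sub d1).sub d2).sub d3).sub_const
    (xlnx (p 4 + q 3 - y) + xlnx (p 5 + q 4 - y) + xlnx (y - p 4) + xlnx (y - p 5) + xlnx (y - p 6))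
  refine (sum.congr_of_eventuallyEq (Filter.Eventually.of_forall fun z => ?_)).congr_deriv ?_
  · simp only [Pi.add_apply, Pi.sub_apply, entropyG]; ring_nf
  · have e1 : x + (y + q 2 - p 0 - p 6) = x + y + q 2 - p 0 - p 6 := by ring
    have e2 : x + -p 0 = x - p 0 := by ring
    have e3 : x + -p 1 = x - p 1 := by ring
    have e4 : x + -p 2 = x - p 2 := by ring
    have e5 : x + (y - p 3) = x + y - p 3 := by ring
    simp only [entropyGx, e1, e2, e3, e4, e5]; ring

/-- **`∂G/∂y = Gy`** (all `y`-dependent forms non-zero); `F₂ = 0` is `∂G/∂y = 0`. -/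
theorem hasDerivAt_entropyG_y {p : Fin 7 → ℝ} {q : Fin 5 → ℝ} {x y : ℝ} (hy : y ≠ 0)
    (h3 : x + y - p 3 ≠ 0) (h6 : x + y + q 2 - p 0 - p 6 ≠ 0) (h7 : y - p 4 ≠ 0) (h8 : y - p 5 ≠ 0)
    (h9 : y - p 6 ≠ 0) (h10 : p 4 + q 3 - y ≠ 0) (h11 : p 5 + q 4 - y ≠ 0) :
    HasDerivAt (fun y => entropyG p q x y) (entropyGy p q x y) y := by
  have dy : HasDerivAt (fun y => xlnx y) (Real.log |y|) y := hasDerivAt_xlnx hy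
  have d6 := hasDerivAt_xlnx_add y (x + q 2 - p 0 - p 6) (by intro h; apply h6; linarith)
  have d3 := hasDerivAt_xlnx_add y (x - p 3) (by intro h; apply h3; linarith)
  have d10 := hasDerivAt_xlnx_sub y (p 4 + q 3) h10
  have d11 := hasDerivAt_xlnx_sub y (p 5 + q 4) h11
  have d7 := hasDerivAt_xlnx_add y (-p 4) (by intro h; apply h7; linarith)
  have d8 := hasDerivAt_xlnx_add y (-p 5) (by intro h; apply h8; linarith)
  have d9 := hasDerivAt_xlnx_add y (-p 6) (by intro h; apply h9; linarith)
  have sum := ((((((((dy.const_add (xlnx x)).add d6).sub d3).sub d10).sub d11).sub d7).sub d8).sub d9).sub_const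
    (xlnx (p 1 + q 0 - x) + xlnx (p 2 + q 1 - x) + xlnx (x - p 0) + xlnx (x - p 1) + xlnx (x - p 2))
  refine (sum.congr_of_eventuallyEq (Filter.Eventually.of_forall fun z => ?_)).congr_deriv ?_
  · simp only [Pi.add_apply, Pi.sub_apply, entropyG]; ring_nf
  · have e1 : y + (x + q 2 - p 0 - p 6) = x + y + q 2 - p 0 - p 6 := by ring
    have e2 : y + -p 4 = y - p 4 := by ring
    have e3 : y + -p 5 = y - p 5 := by ring
    have e4 : y + -p 6 = y - p 6 := by ring
    have e5 : y + (x - p 3) = x + y - p 3 := by ring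
    simp only [entropyGy, e1, e2, e3, e4, e5]; ring

end Summit.KontsevichZagierPeriods.Zeta5Search.Barrier.ConeGamma

end
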